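import Summits.Ventures.PercRepro.RankLevelSetCoreSevenOfFormSplitKY
import Summits.Ventures.PercRepro.RankLevelSetCoreSevenOfForm
import Summits.Ventures.PercRepro.S1TriangleCountBootSix
import Summits.Ventures.PercRepro.S1CoreFourCircuitSum
import Summits.Ventures.PercRepro.S1CoreCapEightExactFinal
import Summits.Ventures.PercRepro.S1CoreCapEightExactChain
import Summits.Ventures.PercRepro.S1FiveCircuitCountSharpC
import Summits.Ventures.PercRepro.RankLevelSetLevelSixRowsNineToFifteen
import Summits.Ventures.PercRepro.S3SixWindow
import Summits.Ventures.PercRepro.RankLevelSetLevelSevenRowThirtyNineTelForm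
import Summits.Ventures.PercRepro.RankLevelSetLevelSevenRowThirtyNineTelCellsA
import Summits.Ventures.PercRepro.RankLevelSetLevelSevenRowThirtyNineLarge

/-!
# PercRepro — THE ROW `39` OF LEVEL `7` AT ITS RANK: C-025 AT `q = 7`, `p = 39`, FOR EVERY FINITE MATROID, ON THE TELESCOPING
COUNT WITH THE NULLITY SPLIT IN `k` STEPS, THE BONFERRONI CORRECTION AT LEVEL `7` AND THE SPLIT `Y`-TAIL (THE RE-BASED TRIANGLE COUNT `triBound6` ON THE KERNEL `s₃ ≤ 6` AT NULLITY `4`, T4⁺) (p8, gen 23; a feeder for S4 — the top of the `q = 7` window; the rows `≥ 42` are chained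
in RankLevelSetLevelSevenRowFortyTwoChain)

Level `7` at rank `39` by the per-rank wrapper `rls_succ_large_at 6 7 39` (p8 g0, S3SixWindow): level `6` at `38`
(`c025_six_all`) and the `e`-free core at `(39, d)` for every `d ≥ 8` — the cells `8 ≤ d ≤ 147` by their numeric forms ON
THE TELESCOPING COUNT (`tel_form39`, RankLevelSetLevelSevenRowThirtyNineTelForm: the `N`-side `nsideTel 39 d S3 S4 S5` with the
disjoint pair count and the per-level minimum of the quartic pair bound and the coloop telescoping; the nullity-capped
`Y`-tail or the count-based one, THE NULLITY SPLIT IN `k` STEPS per cell, THE BONFERRONI CORRECTION AT LEVEL `7`) through `c025_core_seven_of_form_splitky` (RankLevelSetCoreSevenOfFormSplitKY) with `hs3` from THE RE-BASED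
TRIANGLE COUNT `S1.ncard_triangles_le_triBound6` (S1TriangleCountBootSix: the kernel `s₃ ≤ 6` at nullity `4`, S1TriangleKernelFour, under (C1) and (C2) — planes of the core have `≤ 6` points, `ncard_le_six_of_eRk_le_three_of_free`), `hs4` from p1's EXACT s₄ CHAIN at `d = 8 … 13`
(`S1.ncard_fourCircuits_le_eighty_seven` … `…_three_hundred_sixty_nine`, S1CoreCapEightExactFinal / S1CoreCapEightExactChain — the cells
`8 ≤ d ≤ 13` carry the literal values) and from p1's T4⁺ `S1.ncard_fourCircuits_le_fourCircuitBound` (S1CoreFourCircuitSum) at `d ≥ 14`, and `hs5` from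
`S1.fortyEight_mul_ncard_five_circuits_le_sharp` (S1FiveCircuitCountSharpC), the coranks `d ≥ 148` by the large-corank
inequality at `(39, n ≥ 187)` (`largeSeven_all39`) through `c025_core_seven_large_of_ineq` (RankLevelSetCoreSevenOfForm).
* **`c025_core_seven_at_thirty_nine`** — the `e`-free core at rank `39`, every corank `d ≥ 8`;
* **`c025_seven_at_thirty_nine`** — level `7` at rank `39`, every finite matroid.
Axioms: standard.
-/

open scoped Matroid

namespace PercRepro

namespace ThmN

variable {α : Type}

/-- **The `e`-free core of level `7` at rank `39`, every corank `d ≥ 8`**: the numeric forms of the cells `(39, 8 … 147)` on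
the telescoping count with the re-based triangle count, p1's exact s₄ chain (`d ≤ 13`) / T4⁺ (`d ≥ 14`) and the sharp five-circuit count, the capped tail, and the
large-corank inequality at `(39, n ≥ 187)`. -/
theorem c025_core_seven_at_thirty_nine (M : Matroid α) [M.Finite] (d : ℕ) (hd8 : 8 ≤ d) (hR : M.eRank = (39 : ℕ∞))
    (hn : M.E.ncard = 39 + d) (hfree : EFree M) : RLS M 39 7 := by
  rcases Nat.lt_or_ge d 148 with h | h
  · -- the circuit bounds: the re-based triangle count, T4⁺ and the sharp five-circuit count
    have hd : M.E.encard = M.eRank + d := by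
      rw [hR, ← M.ground_finite.cast_ncard_eq, hn]
      push_cast
      ring
    have hs : ∀ e ∈ M.E, ∀ f ∈ M.E, e ≠ f → M.eRk {e, f} = 2 := by
      intro e he f hf hef
      have h2 : (2 : ℕ∞) ≤ M.eRk {e, f} :=
        two_le_eRk_of_two_le_ncard_of_free M hfree (Set.pair_subset he hf) (by rw [Set.ncard_pair hef])
      have h3 : M.eRk {e, f} ≤ 2 := by
        have := M.eRk_le_encard {e, f}
        rwa [Set.encard_pair hef] at this
      exact le_antisymm h3 h2
    have hC1 : ∀ L ⊆ M.E, M.eRk L = 2 → L.ncard ≤ 3 :=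
      fun L hL hr => ncard_le_three_of_eRk_two M hs hfree hL hr
    have hC2 : ∀ X ⊆ M.E, M.eRk X ≤ 3 → X.ncard ≤ 6 :=
      fun X hX hr => ncard_le_six_of_eRk_le_three_of_free M hfree hX hr
    have hC3 : ∀ X ⊆ M.E, M.eRk X ≤ 4 → X.ncard ≤ 10 :=
      fun X hX hr => ncard_le_ten_of_eRk_le_four_of_free M hfree hX hr
    have hs3 : {C | M.IsCircuit C ∧ C.ncard = 3}.ncard ≤ S1.triBound6 d :=
      S1.ncard_triangles_le_triBound6 M hC1 hC2 hd
    have hs5 : {C | M.IsCircuit C ∧ C.ncard = 5}.ncard ≤ 7 * d * (d + 1) * (d * d + d + 10) / 48 := by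
      have hT5 : 48 * {C : Set α | M.IsCircuit C ∧ C.ncard = 5}.ncard ≤ 7 * d * (d + 1) * (d * d + d + 10) :=
        S1.fortyEight_mul_ncard_five_circuits_le_sharp M hC3 hd
      rw [Nat.le_div_iff_mul_le (by norm_num)]
      linarith [hT5]
    rcases Nat.lt_or_ge d 14 with h14 | h14
    · -- the coranks `8 … 13`: p1's exact s₄ chain by name, the cells with the literal values
      interval_cases d
      · have hs3' : {C | M.IsCircuit C ∧ C.ncard = 3}.ncard ≤ 22 := by
          have h := hs3
          rwa [S1.triBound6_val_8] at h
        have hs4 : {C | M.IsCircuit C ∧ C.ncard = 4}.ncard ≤ 87 :=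
          S1.ncard_fourCircuits_le_eighty_seven M hfree hd
        exact c025_core_seven_of_form_splitky M 39 8 22 87
          (7 * 8 * (8 + 1) * (8 * 8 + 8 + 10) / 48) hd8 hR hn hfree hs3' hs4 hs5 (by norm_num) (by omega)
          tel_form39_8
      · have hs3' : {C | M.IsCircuit C ∧ C.ncard = 3}.ncard ≤ 28 := by
          have h := hs3
          rwa [S1.triBound6_val_9] at h
        have hs4 : {C | M.IsCircuit C ∧ C.ncard = 4}.ncard ≤ 121 :=
          S1.ncard_fourCircuits_le_one_hundred_twenty_one M hfree hd
        exact c025_core_seven_of_form_splitky M 39 9 28 121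
          (7 * 9 * (9 + 1) * (9 * 9 + 9 + 10) / 48) hd8 hR hn hfree hs3' hs4 hs5 (by norm_num) (by omega)
          tel_form39_9
      · have hs3' : {C | M.IsCircuit C ∧ C.ncard = 3}.ncard ≤ 35 := by
          have h := hs3
          rwa [S1.triBound6_val_10] at h
        have hs4 : {C | M.IsCircuit C ∧ C.ncard = 4}.ncard ≤ 165 :=
          S1.ncard_fourCircuits_le_one_hundred_sixty_five M hfree hd
        exact c025_core_seven_of_form_splitky M 39 10 35 165
          (7 * 10 * (10 + 1) * (10 * 10 + 10 + 10) / 48) hd8 hR hn hfree hs3' hs4 hs5 (by norm_num) (by omega)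
          tel_form39_10
      · have hs3' : {C | M.IsCircuit C ∧ C.ncard = 3}.ncard ≤ 42 := by
          have h := hs3
          rwa [S1.triBound6_val_11] at h
        have hs4 : {C | M.IsCircuit C ∧ C.ncard = 4}.ncard ≤ 220 :=
          S1.ncard_fourCircuits_le_two_hundred_twenty M hfree hd
        exact c025_core_seven_of_form_splitky M 39 11 42 220
          (7 * 11 * (11 + 1) * (11 * 11 + 11 + 10) / 48) hd8 hR hn hfree hs3' hs4 hs5 (by norm_num) (by omega)
          tel_form39_11
      · have hs3' : {C | M.IsCircuit C ∧ C.ncard = 3}.ncard ≤ 50 := by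
          have h := hs3
          rwa [S1.triBound6_val_12] at h
        have hs4 : {C | M.IsCircuit C ∧ C.ncard = 4}.ncard ≤ 287 :=
          S1.ncard_fourCircuits_le_two_hundred_eighty_seven M hfree hd
        exact c025_core_seven_of_form_splitky M 39 12 50 287
          (7 * 12 * (12 + 1) * (12 * 12 + 12 + 10) / 48) hd8 hR hn hfree hs3' hs4 hs5 (by norm_num) (by omega)
          tel_form39_12
      · have hs3' : {C | M.IsCircuit C ∧ C.ncard = 3}.ncard ≤ 59 := by
          have h := hs3
          rwa [S1.triBound6_val_13] at h
        have hs4 : {C | M.IsCircuit C ∧ C.ncard = 4}.ncard ≤ 369 :=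
          S1.ncard_fourCircuits_le_three_hundred_sixty_nine M hfree hd
        exact c025_core_seven_of_form_splitky M 39 13 59 369
          (7 * 13 * (13 + 1) * (13 * 13 + 13 + 10) / 48) hd8 hR hn hfree hs3' hs4 hs5 (by norm_num) (by omega)
          tel_form39_13
    · -- the coranks `14 … 147`: T4⁺ in the S4 slot, the dispatcher
      have hs4 : {C | M.IsCircuit C ∧ C.ncard = 4}.ncard ≤ S1.fourCircuitBound d :=
        S1.ncard_fourCircuits_le_fourCircuitBound M hfree hd
      exact c025_core_seven_of_form_splitky M 39 d (S1.triBound6 d) (S1.fourCircuitBound d)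
        (7 * d * (d + 1) * (d * d + d + 10) / 48) hd8 hR hn hfree hs3 hs4 hs5 (by norm_num) (by omega)
        (tel_form39 d h14 (by omega))
  · exact c025_core_seven_large_of_ineq M 39 hR (largeSeven_all39 M.E.ncard (by omega)) hfree

/-- **Level `7` at rank `39`, every finite matroid**: `rls_succ_large_at 6 7 39` on level `6` at `38` (`c025_six_all`), the
coranks `≤ 7` (`U = ∅` or Theorem M) and the core at `39`. -/
theorem c025_seven_at_thirty_nine (M : Matroid α) [M.Finite] : RLS M 39 7 := by
  refine rls_succ_large_at (α := α) 6 7 39 (by norm_num) (fun M _ => c025_six_all M 38 (by norm_num)) ?_ ?_ M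
  · -- corank `≤ 7`: `U = ∅` or Theorem M
    intro M _ hn
    rcases Nat.lt_or_ge M.E.ncard (39 + 7) with h | h
    · exact RLS_of_ncard_lt M h
    · exact RLS_of_ncard_eq M (by omega)
  · -- the core at corank `≥ 8`
    intro M _ hR hbig hfree
    exact c025_core_seven_at_thirty_nine M (M.E.ncard - 39) (by omega) hR (by omega) hfree

end ThmN

end PercRepro
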